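import Literature.Geometry.Riemannian.RicciFlowMaximal
import Literature.Geometry.Riemannian.RicciFlowScaling
import HarnessLib

/-!
# Parabolic rescaling of maximal Ricci flows; "we may assume `T₀ > 1`"
(topic `Geometry/Riemannian`)

Proved glue for the decomposition of `Literature.Geometry.Riemannian.hamilton_chen_tang_zhu`
(`HamiltonPICProofs.lean`), combining `RicciFlowMaximal.lean` (maximal solutions,
`IsMaximalRicciFlow`) with the parabolic rescaling of `RicciFlowScaling.lean`
(`IsRicciFlow.parabolicRescale`, Topping 2006, §1.2.3, (1.2.7)):

* `IsMaximalRicciFlow.parabolicRescale` — if `(g, cov)` is a maximal Ricci flow on `[0, T)`,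
  then for every `λ > 0` the rescaled flow `t ↦ λ • g(t/λ)` (same connections) is a maximal
  Ricci flow on `[0, λT)`: an extension of the rescaled flow past `λT` would rescale back
  (by `λ⁻¹`) to an extension of `g` past `T`.
* `curvatureBoundedBy_constSmul_iff`, `blowup_parabolicRescale` — `|Rm|` scales like `λ⁻¹`
  under `g ↦ λ g` (Topping 2006, §1.2.3), so curvature bounds `CurvatureBoundedBy` transform by
  `C ↦ λ C` and curvature blow-up is invariant under parabolic rescaling (proved).
* `exists_isMaximalRicciFlow_one_lt_of_isMaximalRicciFlow` — **"Without loss of generality,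
  after a scaling on the initial metric, we may assume `T₀ > 1`"** (Chen–Zhu 2006, §5, arXiv
  p. 26): from a maximal flow with initial metric `g₀` one obtains, for `λ = 2/T`, a maximal flow
  with initial metric `λ • g₀` and final time `2 > 1`; positive isotropic curvature of the
  initial metric is unchanged (`hasPositiveIsotropicCurvature_constSmul_iff`). This is the
  normalisation under which the named fact `chenZhu_aprioriAssumptions_smoothSolution`
  (`CanonicalNeighbourhoods.lean`) is stated.

## References

* P. Topping, *Lectures on the Ricci flow*, LMS LNS 325 (2006), §1.2.3, (1.2.7) (parabolic
  rescaling), §5.2, p. 46 (maximal solutions). [Topping2006]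
* B.-L. Chen, X.-P. Zhu, J. Differential Geom. 74 (2006), §5, p. 26 (arXiv:math/0504478).
  [ChenZhu2006]
-/

noncomputable section

open Set
open scoped Manifold ContDiff Topology

namespace Literature.Geometry.Riemannian

open Lorentzian Lorentzian.PseudoRiemannianMetric

variable {E : Type*} [NormedAddCommGroup E] [NormedSpace ℝ E] [FiniteDimensional ℝ E]
  [CompleteSpace E] {H : Type*} [TopologicalSpace H] {I : ModelWithCorners ℝ E H}
  {M : Type*} [TopologicalSpace M] [ChartedSpace H M] [IsManifold I ∞ M]
  {g : ℝ → PseudoRiemannianMetric I ∞ E (TangentSpace I : M → Type _)}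
  {cov : ℝ → CovariantDerivative I E (TangentSpace I : M → Type _)} {T : ℝ}

omit [FiniteDimensional ℝ E] [CompleteSpace E] [IsManifold I ∞ M] in
/-- The rescaled half-open time interval: `(λ⁻¹ ·)⁻¹' [0, T) = [0, λT)` for `λ > 0`. [folklore] -/
theorem preimage_const_mul_Ico {c : ℝ} (hc : 0 < c) (T : ℝ) :
    (fun t : ℝ ↦ c⁻¹ * t) ⁻¹' Ico 0 T = Ico 0 (c * T) := by
  ext t
  simp only [mem_preimage, mem_Ico]
  constructor
  · rintro ⟨h0, hT⟩
    refine ⟨?_, ?_⟩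
    · have := mul_nonneg hc.le h0
      rwa [mul_inv_cancel_left₀ hc.ne'] at this
    · have := mul_lt_mul_of_pos_left hT hc
      rwa [mul_inv_cancel_left₀ hc.ne'] at this
  · rintro ⟨h0, hT⟩
    refine ⟨mul_nonneg (inv_pos.2 hc).le h0, ?_⟩
    have := mul_lt_mul_of_pos_left hT (inv_pos.2 hc)
    rwa [inv_mul_cancel_left₀ hc.ne'] at this

/-- **Parabolic rescaling of a maximal Ricci flow is maximal.** If `(g, cov)` is a maximal Ricci
flow on `[0, T)` then, for `λ > 0`, `t ↦ λ • g(t/λ)` with connections `t ↦ cov(t/λ)` is a maximal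
Ricci flow on `[0, λT)` (Topping 2006, §1.2.3, (1.2.7) for the rescaling; maximality: an
extension to `[0, λT + ε)` rescales back by `λ⁻¹` — `IsRicciFlow.parabolicRescale` again, and
`λ⁻¹ • (λ • h) = h` — to an extension of `g` to `[0, T + ε/λ)`, contradicting maximality).
[cite: Topping2006, §1.2.3, (1.2.7)] [cite: Topping2006, §5.2, p. 46 (definition of maximal)] -/
theorem IsMaximalRicciFlow.parabolicRescale (h : IsMaximalRicciFlow g cov T) {c : ℝ} (hc : 0 < c) :
    IsMaximalRicciFlow (fun t ↦ (g (c⁻¹ * t)).constSmul c hc.ne') (fun t ↦ cov (c⁻¹ * t))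
      (c * T) where
  pos := mul_pos hc h.pos
  isRicciFlow := by
    have hflow := h.isRicciFlow.parabolicRescale hc
    rwa [preimage_const_mul_Ico hc] at hflow
  isRiemannian := by
    have hR := isRiemannian_parabolicRescale (g := g) (S := Ico 0 T) hc h.isRiemannian
    rwa [preimage_const_mul_Ico hc] at hR
  not_exists_extension := by
    rintro ⟨ε, hε, g', cov', hflow', hR', hagree⟩
    -- rescale the putative extension back by `c⁻¹`
    have hc' : 0 < c⁻¹ := inv_pos.2 hc
    have hflow'' := hflow'.parabolicRescale hc'
    have hR'' := isRiemannian_parabolicRescale (g := g') (S := Ico 0 (c * T + ε)) hc' hR'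
    rw [preimage_const_mul_Ico hc'] at hflow'' hR''
    have hT' : T < c⁻¹ * (c * T + ε) := by
      rw [mul_add, inv_mul_cancel_left₀ hc.ne']
      linarith [mul_pos hc' hε]
    refine h.not_extends hT' hflow'' hR'' fun t ht ↦ ?_
    -- agreement on `[0, T)`: `c⁻¹ • g'(c t) = c⁻¹ • (c • g((c⁻¹ (c t))) = g t`
    have hct : (c⁻¹)⁻¹ * t ∈ Ico 0 (c * T) := by
      rw [inv_inv]
      exact ⟨mul_nonneg hc.le ht.1, mul_lt_mul_of_pos_left ht.2 hc⟩
    have hg' := hagree _ hct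
    rw [hg', inv_inv, inv_mul_cancel_left₀ hc.ne', constSmul_inv_constSmul]

omit [FiniteDimensional ℝ E] [CompleteSpace E] in
/-- The initial metric of the rescaled flow is `λ • g(0)`. [folklore] -/
theorem parabolicRescale_zero {c : ℝ} (hc : 0 < c) :
    (fun t ↦ (g (c⁻¹ * t)).constSmul c hc.ne') 0 = (g 0).constSmul c hc.ne' := by
  simp

/-- **"We may assume `T₀ > 1`"** (Chen–Zhu 2006, §5, arXiv p. 26: "Without loss of generality,
after a scaling on the initial metric, we may assume `T₀ > 1`"). Given a maximal Ricci flow on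
`[0, T)` with initial metric `g₀` there are `λ > 0` and a maximal Ricci flow on `[0, 2)` with
initial metric `λ • g₀` — the parabolic rescaling by `λ = 2/T`; the rescaled initial metric has
positive isotropic curvature iff `g₀` has (`hasPositiveIsotropicCurvature_constSmul_iff`).
[cite: ChenZhu2006, §5, p. 26] [cite: Topping2006, §1.2.3, (1.2.7)] -/
theorem exists_isMaximalRicciFlow_one_lt_of_isMaximalRicciFlow (h : IsMaximalRicciFlow g cov T) :
    ∃ (c : ℝ) (hc : 0 < c) (g' : ℝ → PseudoRiemannianMetric I ∞ E (TangentSpace I : M → Type _))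
      (cov' : ℝ → CovariantDerivative I E (TangentSpace I : M → Type _)) (T' : ℝ),
      IsMaximalRicciFlow g' cov' T' ∧ 1 < T' ∧ g' 0 = (g 0).constSmul c hc.ne' ∧
      (∀ t, g' t = (g (c⁻¹ * t)).constSmul c hc.ne') ∧ ∀ t, cov' t = cov (c⁻¹ * t) := by
  have hc : 0 < 2 / T := div_pos two_pos h.pos
  refine ⟨2 / T, hc, fun t ↦ (g ((2 / T)⁻¹ * t)).constSmul (2 / T) hc.ne',
    fun t ↦ cov ((2 / T)⁻¹ * t), 2 / T * T, h.parabolicRescale hc, ?_, by simp, fun t ↦ rfl,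
    fun t ↦ rfl⟩
  rw [div_mul_cancel₀ _ h.pos.ne']
  norm_num

/-- The same normalisation for PIC initial data on a 4-manifold: from a maximal flow with
`g 0` of positive isotropic curvature one gets a maximal flow with final time `> 1` whose
initial metric (a positive constant multiple of `g 0`) again has positive isotropic curvature
(the metrics of a maximal flow being Riemannian by definition of `IsMaximalRicciFlow`).
[cite: ChenZhu2006, §5, p. 26] -/
theorem exists_isMaximalRicciFlow_one_lt_of_hasPositiveIsotropicCurvature
    (h : IsMaximalRicciFlow g cov T) (hpic : (g 0).HasPositiveIsotropicCurvature) :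
    ∃ (g' : ℝ → PseudoRiemannianMetric I ∞ E (TangentSpace I : M → Type _))
      (cov' : ℝ → CovariantDerivative I E (TangentSpace I : M → Type _)) (T' : ℝ),
      IsMaximalRicciFlow g' cov' T' ∧ 1 < T' ∧ (g' 0).HasPositiveIsotropicCurvature ∧
      ∃ (c : ℝ) (hc : 0 < c), (∀ t, g' t = (g (c⁻¹ * t)).constSmul c hc.ne') ∧
        ∀ t, cov' t = cov (c⁻¹ * t) := by
  obtain ⟨c, hc, g', cov', T', hmax, hT', h0, hg', hcov'⟩ :=
    exists_isMaximalRicciFlow_one_lt_of_isMaximalRicciFlow h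
  refine ⟨g', cov', T', hmax, hT', ?_, c, hc, hg', hcov'⟩
  rw [h0]
  exact hpic.constSmul hc

/-! ### Curvature bounds under homothety -/

omit [FiniteDimensional ℝ E] [CompleteSpace E] in
/-- `Rm` is homogeneous of degree `4` under scaling of its arguments: for the covariant curvature
tensor of any connection, `Rm(aX, aY, aZ, aW) = a⁴ Rm(X, Y, Z, W)`. [folklore] -/
theorem curvatureForm_smul_smul_smul_smul {n : ℕ∞ω}
    (h : PseudoRiemannianMetric I n E (TangentSpace I : M → Type _))
    (cov₀ : CovariantDerivative I E (TangentSpace I : M → Type _)) (x : M) (a : ℝ)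
    (X Y Z W : TangentSpace I x) :
    h.curvatureForm cov₀ x (a • X) (a • Y) (a • Z) (a • W) =
      a ^ 4 * h.curvatureForm cov₀ x X Y Z W := by
  simp only [curvatureForm, map_smul, smul_apply, smul_eq_mul]
  ring

omit [FiniteDimensional ℝ E] [CompleteSpace E] in
/-- **Curvature bounds under homothety**: for `c > 0` the curvature of `(c • h, cov₀)` is bounded
by `C` (on `c • h`-unit vectors) iff the curvature of `(h, cov₀)` is bounded by `c C` (on
`h`-unit vectors) — `|Rm|` scales like `c⁻¹` under `h ↦ c h` (Topping 2006, §1.2.3: under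
`g ↦ λ g`, "`|Rm| ↦ λ⁻¹ |Rm|`"). Substitute `X ↦ c^{∓1/2} X` and use the degree-4 homogeneity
of `Rm` and `Rm_{c h} = c Rm_h` (`curvatureForm_constSmul`). [cite: Topping2006, §1.2.3] -/
theorem curvatureBoundedBy_constSmul_iff {n : ℕ∞ω}
    (h : PseudoRiemannianMetric I n E (TangentSpace I : M → Type _))
    (cov₀ : CovariantDerivative I E (TangentSpace I : M → Type _)) {c : ℝ} (hc : 0 < c) (C : ℝ) :
    CurvatureBoundedBy (h.constSmul c hc.ne') cov₀ C ↔ CurvatureBoundedBy h cov₀ (c * C) := by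
  have hsq : Real.sqrt c ^ 2 = c := Real.sq_sqrt hc.le
  have hsqpos : 0 < Real.sqrt c := Real.sqrt_pos.2 hc
  have h4 : Real.sqrt c ^ 4 = c ^ 2 := by
    calc Real.sqrt c ^ 4 = (Real.sqrt c ^ 2) ^ 2 := by ring
      _ = c ^ 2 := by rw [hsq]
  have h4' : (Real.sqrt c)⁻¹ ^ 4 = (c ^ 2)⁻¹ := by rw [inv_pow, h4]
  -- unit conditions transform under `X ↦ a • X`
  have hunit : ∀ (x : M) (a : ℝ) (X : TangentSpace I x),
      h.val x (a • X) (a • X) = a ^ 2 * h.val x X X := by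
    intro x a X
    simp only [map_smul, smul_apply, smul_eq_mul]
    ring
  constructor
  · intro hb x X Y Z W hX hY hZ hW
    -- apply the bound to `c^{-1/2} •` the vectors, which are `c • h`-unit
    set a : ℝ := (Real.sqrt c)⁻¹ with ha
    have ha2 : c * a ^ 2 = 1 := by
      rw [ha, inv_pow, hsq, mul_inv_cancel₀ hc.ne']
    have hu : ∀ V : TangentSpace I x, h.val x V V ≤ 1 →
        (h.constSmul c hc.ne').val x (a • V) (a • V) ≤ 1 := by
      intro V hV
      rw [constSmul_apply, hunit, ← mul_assoc, ha2, one_mul]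
      exact hV
    have key := hb x (a • X) (a • Y) (a • Z) (a • W) (hu X hX) (hu Y hY) (hu Z hZ) (hu W hW)
    rw [curvatureForm_constSmul, curvatureForm_smul_smul_smul_smul, ha, h4'] at key
    -- `key : |c * ((c²)⁻¹ * Rm)| ≤ C`, i.e. `c⁻¹ |Rm| ≤ C`
    have hc2 : c * (c ^ 2)⁻¹ = c⁻¹ := by field_simp
    rw [← mul_assoc, hc2, abs_mul, abs_inv, abs_of_pos hc] at key
    rwa [inv_mul_le_iff₀ hc] at key
  · intro hb x X Y Z W hX hY hZ hW
    -- apply the bound to `c^{1/2} •` the vectors, which are `h`-unit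
    set a : ℝ := Real.sqrt c with ha
    have hu : ∀ V : TangentSpace I x, (h.constSmul c hc.ne').val x V V ≤ 1 →
        h.val x (a • V) (a • V) ≤ 1 := by
      intro V hV
      rw [hunit, ha, hsq]
      rwa [constSmul_apply] at hV
    have key := hb x (a • X) (a • Y) (a • Z) (a • W) (hu X hX) (hu Y hY) (hu Z hZ) (hu W hW)
    rw [curvatureForm_smul_smul_smul_smul, ha, h4, abs_mul, abs_of_pos (pow_pos hc 2)] at key
    rw [curvatureForm_constSmul, abs_mul, abs_of_pos hc]
    -- `key : c² |Rm| ≤ c C`; goal: `c |Rm| ≤ C`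
    have := mul_le_mul_of_nonneg_left key (inv_pos.2 hc).le
    calc c * |h.curvatureForm cov₀ x X Y Z W|
        = c⁻¹ * (c ^ 2 * |h.curvatureForm cov₀ x X Y Z W|) := by field_simp
      _ ≤ c⁻¹ * (c * C) := this
      _ = C := by field_simp

omit [FiniteDimensional ℝ E] [CompleteSpace E] in
/-- **Curvature blow-up is invariant under parabolic rescaling**: if the curvature of `(g, cov)`
is eventually unbounded as `t ↑ T` (for every `C` there is `t₀ < T` after which no bound `C`
holds), then the same is true for the rescaled flow `t ↦ λ • g(t/λ)` as `t ↑ λT`.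
[cite: Topping2006, §1.2.3] -/
theorem blowup_parabolicRescale {c : ℝ} (hc : 0 < c)
    (hblow : ∀ C : ℝ, ∃ t₀ ∈ Ico 0 T, ∀ t ∈ Ico t₀ T, ¬ CurvatureBoundedBy (g t) (cov t) C) :
    ∀ C : ℝ, ∃ t₀ ∈ Ico 0 (c * T), ∀ t ∈ Ico t₀ (c * T),
      ¬ CurvatureBoundedBy ((g (c⁻¹ * t)).constSmul c hc.ne') (cov (c⁻¹ * t)) C := by
  intro C
  obtain ⟨t₀, ht₀, hno⟩ := hblow (c * C)
  refine ⟨c * t₀, ⟨mul_nonneg hc.le ht₀.1, mul_lt_mul_of_pos_left ht₀.2 hc⟩, fun t ht hb ↦ ?_⟩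
  have ht' : c⁻¹ * t ∈ Ico t₀ T := by
    refine ⟨?_, ?_⟩
    · have := mul_le_mul_of_nonneg_left ht.1 (inv_pos.2 hc).le
      rwa [inv_mul_cancel_left₀ hc.ne'] at this
    · have := mul_lt_mul_of_pos_left ht.2 (inv_pos.2 hc)
      rwa [inv_mul_cancel_left₀ hc.ne'] at this
  exact hno _ ht' ((curvatureBoundedBy_constSmul_iff (g (c⁻¹ * t)) (cov (c⁻¹ * t)) hc C).1 hb)

end Literature.Geometry.Riemannian

end
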